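import Literature.Geometry.Lorentzian.StabilityCauchy
import Literature.Geometry.Lorentzian.LeviCivitaProofs
import HarnessLib

/-!
# Nonlinear stability of Kerr in the full sub-extremal range (Hintz 2026), Cauchy consequence form

`Literature.Geometry.Lorentzian.StabilityCauchy` vendors the slowly rotating theorem of
Klainerman–Szeftel as the named fact `klainerman_szeftel_kerr_stability_small_a_cauchy` (gr.S05,
refereed). This file records — under a NEW name, and as an UNREFEREED CLAIM
(`@[claim "Hintz2026" "under-review"]`, D-0012) — the full-sub-extremal-range theorem announced in

* P. Hintz, *Nonlinear stability of subextremal Kerr black holes*, arXiv:2606.28253 (v2 of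
  2026-08-03, 509 pp.; companions arXiv:2606.27658 and arXiv:2606.28008), Thm. 1.1 (p. 2) with its
  precise version Thm. 13.1 (pp. 318–319) and Remarks 13.2–13.3 (pp. 319–320),

in EXACTLY the consequence-form conventions fixed for this source by the barrier audit of
2026-08-15 (`Literature.Barriers.FinalStateConjecture.SlowlyRotatingKerrFrontierNarrow.conormalData`,
whose conclusion is the pointwise shape `hintz_kerr_stability_subextremal_cauchy.pointwise` proves
below): truncated horizon-penetrating Kerr–Schild slices `Kerr.slice a r₀`, `r₀ ∈ (r₋, r₊)`; data
balls in `InitialDataSet.dataWeightedSobolevEDist` with the b-conormality side condition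
"finite at every order `s'` at the one weight `δ`" rendering (13.1a) at `E₀ = ∅` (dictionary:
Hintz's `‖·‖²_{H_b^{d,ℓ}} = ∫∫ |r^ℓ (r∂ₓ)^{≤ d} ·|² dω dr/r` carries the weight `r^{2(ℓ+m)−3}` on
`|D^m ·|²`, i.e. `δ = ℓ − 3/2`, so `ℓ = 3 + ε₀ ↔ δ = 3/2 + ε₀`, the `k`-part automatically at
`δ + 1 ↔ 4 + ε₀`) and smallness at one finite order `s` ((13.1b)); maximal vacuum Cauchy developments
`VacuumCauchyDevelopment`/`IsMaximal`; conclusion: a SUB-EXTREMAL Kerr exterior `g_{M',a'}` to which a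
region converges in `Cᵏ` (`Spacetime.ConvergesToKerr`, rates (1)–(3)), final parameters within any
prescribed tolerance `η` for small enough balls (`∀ η, ∃ ε` for "`b` close to `b₀`", the reading of
Dafermos–Rodnianski's Conj. 5.1 used throughout `Stability*.lean`), and far-origin sojourn-complete
`𝓘⁺` (`DataEmbedding.HasCompleteFutureNullInfinityFar`, for the `O(r⁻¹)` control near `𝓘⁺`,
rate (4)). What this file ADDS to the audited pointwise rendering is only the quantifier shape the
source prints for the dependence of its constants on the centre (Remark 13.2): the theorem at centre
`b₀` serves every `b₁` with `|b₁ − b₀| < ε` at the SAME inner radius, so one `(s, δ, k)` and, per mass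
and tolerance, one `ε` serve a whole ball of normalised spins around each sub-extremal centre.

A second rendering, `hintz_kerr_stability_subextremal_cauchy_allOrders` (re-vendoring of
2026-08-16, item wi-30700), hands the convergence order over: `∃ (s, δ)` up front and `∀ k` in the
conclusion (same `ε` for every `k`) — the reading of the printed conclusion (13.2), an
`H_b^∞`-membership of the metric perturbation (all b-derivatives), and of Thm. 1.1's clause
"similarly for finite-order derivatives of `g − g_b`"; it implies the first rendering
(`….toExistsOrder`) and has the `k = 2` instance `….orderTwo`.

## Deliberately NOT transcribed

(i) any parameter MODULUS `|b − b₀| ≲ ‖data‖^θ` — Thm. 13.1 prints "with `|b − b₀|` and `|S|`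
small"; a Lipschitz/Hölder bound lives in the proof of [SR89] as invoked in Step 3 (p. 322) and is
not a printed statement for Kerr (contrast Klainerman–Szeftel (3.4.7)–(3.4.8), whence the `C √dist`
of gr.S05-cauchy); (ii) the finite-regularity data class: the ball here carries the b-conormality
side condition of (13.1a) — a bare finite-order `H^s_δ`-ball is NOT covered by the printed
hypothesis (audit 2026-08-15, `SlowlyRotatingKerrFrontierProofs`, §"Review-split audit", (ii));
(iii) uniformity of anything as `|a₀| → m₀` (Remark 1.4, p. 5: the structure used holds
"throughout the subextremal range (but not on extremal Kerr)"); (iv) polyhomogeneity at `𝓘⁺`/`ι⁺`,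
the gauge, the boost `S`, the `t_*⁻³` sharpening (Thm. 13.5).

## References

* P. Hintz, arXiv:2606.28253v2: Thm. 1.1 (p. 2), footnotes 1–2 (pp. 2–3), Remark 1.3 (p. 3),
  Remark 1.4 (p. 5), §5.7.1, Thm. 13.1 (pp. 318–319), Remarks 13.2–13.3 (pp. 319–320), proof of
  Thm. 13.1, Steps 1–4 (pp. 320–323). Bib key `Hintz2026`.
* S. Klainerman, J. Szeftel, PAMQ 19 (2023) = arXiv:2104.11857 (the slowly rotating precedent and
  its conventions). Bib key `KlainermanSzeftel2023`.
* M. Dafermos, I. Rodnianski, arXiv:0811.0354, §2.6.2, §5.1, Conj. 5.1. Bib key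
  `DafermosRodnianski2008`.
-/

noncomputable section

open Set TopologicalSpace Filter
open scoped ContDiff ENNReal Manifold Topology

namespace Literature.Geometry.Lorentzian

/-- **Nonlinear stability of sub-extremal Kerr (Hintz 2026) — Cauchy consequence form, locally
uniform in the centre.** Named fact, UNREFEREED CLAIM.

**Source, verbatim.** Thm. 1.1 (p. 2): "Let `b₀ = (m₀, a₀)` be subextremal parameters. Suppose
that the initial data `γ, k ∈ C^∞(Σ; S²T*Σ)` satisfy the constraint equations (1.3). Suppose
moreover that `(γ, k) = (γ_{b₀}, k_{b₀})` outside of a compact set, and that `γ − γ_{b₀}` and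
`k − k_{b₀}` are small in the Sobolev space `H^d(Σ)` for some large `d`. Then there exist subextremal
parameters `b = (m, a)` close to `b₀` such that the MGHD of `(Σ, γ, k)` contains a region isometric to
`(Ω, g)`, where `g` is a Lorentzian metric satisfying
`|g_{μν}(t̃, x) − (g_b)_{μν}(t̃, x)| ≲ (1 + t̃)^{−2−ε_K}` … Furthermore, `g` decays at quantitative rates
in all asymptotic regions of `Ω`, namely `r⁻¹(r/t̃)^{2+ε_K}` for `r/t̃ ≤ 1/4`, further `r⁻¹` for
`r/t̃ ≥ 3/4` (including near null infinity), and finally `t̃⁻¹ log t̃` for `r/t̃ ∈ [1/4, 3/4]`", on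
`Ω = {r ≥ m₀, t̃ ≥ 0}`, `Σ = t̃⁻¹(0)` ((1.2), p. 1). Thm. 13.1 (pp. 318–319): "Fix subextremal Kerr
parameters `b₀ = (m₀, a₀)`, `|a₀| < m₀`. … Let `ε₀ > 0`, and let `E₀ ⊂ ℂ × ℕ₀` be an index set …
Then there exist `ε > 0`, `d ∈ ℕ₀`, … such that the following holds. Suppose we are given initial
data `γ, k` on `Σ_IVP` … satisfying the constraint equations, the decay and regularity properties
(13.1a) `γ − γ_{b₀} ∈ H_b^{∞,(E₀,3+ε₀)}(Σ_IVP)`, `k − k_{b₀} ∈ H_b^{∞,(E₀+1,4+ε₀)}(Σ_IVP)`, and the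
smallness conditions (13.1b) `‖γ − γ_{b₀}‖_{H_b^{d,(E₀,3+ε₀)}}, ‖k − k_{b₀}‖_{H_b^{d,(E₀+1,4+ε₀)}} < ε`.
Then there exist `b = (m, a)` and `S ∈ 𝕊₁`, with `|b − b₀|` and `|S|` small, and … `g = g_{b₀,b,−S} + h`
… attains the initial data … and satisfies `Ric(g) = 0`. … `g` settles down to the Kerr metric `g_b`
at the rates (1) `O(t_*^{−2−ε_K})` in spatially compact subsets of `{r ≥ m₀}`, … (4) `O(r⁻¹)` in the
region `r/t_* ≥ C`." Remark 13.2 (p. 319): "Theorem 13.1 remains valid if in the assumptions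
(13.1a)–(13.1b) and in the conclusion (13.3) we replace `b₀` with parameters `b₁` satisfying
`|b₁ − b₀| < ε`; one merely needs to replace all occurrences of `b₀` in the proof by `b₁`. (Recall that
the particular choice `r = m₀` of the interior spacelike boundary hypersurface of `Ω` is
inconsequential; when working with `b₁ = (m₁, a₁)` instead of `b₀`, this choice is still acceptable
as long as `m₀ ∈ (r⁻_{m₁,a₁}, r⁺_{m₁,a₁})` …)". Remark 13.3 (pp. 319–320): "The particular choice of
Cauchy hypersurface is of little consequence" (a Boyer–Lindquist level set near infinity, §5.7.1).

**Statement (tree vocabulary).** For every normalised sub-extremal centre `χ₀ ∈ (−1, 1)` and every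
normalised inner radius `ρ₀ ∈ (1 − √(1 − χ₀²), 1 + √(1 − χ₀²))` (between the horizons of the
unit-mass centre) there are exponents `(s, δ, k)` and a spin radius `ς > 0`; and for every mass
`M > 0` and every tolerance `η > 0` ONE basin radius `ε > 0` serving every spin `a` with
`|a/M − χ₀| < ς` at the inner radius `r₀ = ρ₀ M ∈ (r₋(M,a), r₊(M,a))`: every solution `D` of the
vacuum constraints on `Kerr.slice a r₀` which is b-conormal relative to `Kerr.data M a r₀` at weight
`δ` (finite `H^{s'}_δ × H^{s'−1}_{δ+1}`-distance for every order `s'`, (13.1a) at `E₀ = ∅`) and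
`ε`-close at order `s` ((13.1b)) has all its maximal vacuum Cauchy developments `𝒟` with: a
SUB-EXTREMAL `(M', a')` with `|M' − M| + |a' − a| ≤ η`, sojourn-complete far `𝓘⁺`
(`HasCompleteFutureNullInfinityFar`), and a region `𝒟oc` converging in `Cᵏ` to `g_{M',a'}`
(`ConvergesToKerr`).

**Paraphrase notes** (liberties relative to the printed text, as for gr.S05-cauchy). (α) Shape:
`(s, δ, k, ς)` depend on the centre only through `(a₀/m₀, r₀/m₀)` and `ε` on `(M, η)` — the
dimensionless reading by the scaling covariance `g ↦ λ²g`, `(m, a) ↦ (λm, λa)` of the vacuum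
equations (gr.S05-cauchy takes its `a₀` "uniform in `M` by scale invariance" likewise); local
uniformity of `(ε, d)` over `|a/M − χ₀| < ς` at fixed inner radius is Remark 13.2 read with unchanged
`(ε, d)` (its second half — tail tolerance `O(|a − a₀|)·r⁻²` inside (13.1a) at ONE centre — gives
the same basin uniformity within the source's own data class). (β) Data: b-conormality at the one
weight `δ` (existential; every `δ = 3/2 + ε₀`, `ε₀ > 0`, is admissible in print) and smallness at one
order `s ≥ d`; the polyhomogeneous part `E₀ ≠ ∅` has no carrier in `WeightedNorms` and is dropped
(allowed: weaker claim). (γ) Hypersurface: the Kerr–Schild leaf `{t* = 0}` is not the source's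
`Σ_IVP` (the two differ by `≈ 2M log r` near infinity); Remark 13.3 / §5.7.1 is the licence, as for
the PG/PT-to-`Kerr.slice` move of gr.S05-cauchy. (δ) "`b` close to `b₀`" is rendered `∀ η, ∃ ε`
(the convention of `klainerman_szeftel_kerr_stability_small_a_cauchy.nearness` and of the 2026-08-15
audit); NO modulus. (ε) Far `𝓘⁺`: sojourn-form completeness from far origins stands for the `O(r⁻¹)`
control near `𝓘⁺` (rate (4)) plus null-geodesic comparison — a consequence, not a printed clause
(audit `KerrStabilityHoldsBelowNarrow`, scope_caveat (b)). (ζ) Every maximal development is covered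
(the source speaks of "the MGHD"; Choquet-Bruhat–Geroch uniqueness). (η) Unrefereed (v2,
2026-08-03); mode stability of Andersson–Häfner–Whiting and [Hin26a], [Hin26c] enter as black boxes
(Remark 1.4, p. 5). [cite: Hintz2026, Thm. 1.1 (p. 2); Thm. 13.1 (pp. 318–319); Remarks 13.2–13.3 (pp. 319–320)] -/
@[claim "Hintz2026" "under-review"]
def hintz_kerr_stability_subextremal_cauchy [Kerr.Facts] [Kerr.SliceFacts] : Prop :=
  ∀ χ₀ : ℝ, |χ₀| < 1 → ∀ ρ₀ ∈ Set.Ioo (1 - √(1 - χ₀ ^ 2)) (1 + √(1 - χ₀ ^ 2)),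
    ∃ (s : ℕ) (δ : ℝ) (k : ℕ), ∃ ς > (0 : ℝ), ∀ (M : ℝ) (hM : 0 < M), ∀ η > (0 : ℝ), ∃ ε > (0 : ℝ),
      ∀ a r₀ : ℝ, |a / M - χ₀| < ς → r₀ = ρ₀ * M →
        r₀ ∈ Set.Ioo (Kerr.rMinus M a) (Kerr.rPlus M a) →
        ∀ (D : InitialDataSet 𝓘(ℝ, E3) (Kerr.slice a r₀)) [D.metric.HasLeviCivita],
          D.IsVacuumConstraintSolution →
          (∀ s' : ℕ,
            InitialDataSet.dataWeightedSobolevEDist s' δ D (Kerr.data M a r₀ hM.le) < ⊤) →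
          InitialDataSet.dataWeightedSobolevEDist s δ D (Kerr.data M a r₀ hM.le) <
            ENNReal.ofReal ε →
          ∀ 𝒟 : VacuumCauchyDevelopment D, 𝒟.IsMaximal →
            ∃ (M' a' : ℝ) (𝒟oc : Set 𝒟.carrier), Kerr.IsSubextremal M' a' ∧
              |M' - M| + |a' - a| ≤ η ∧
              𝒟.HasCompleteFutureNullInfinityFar ∧
              𝒟.toSpacetime.ConvergesToKerr 𝒟oc M' a' k

/-- Normalised horizon radii: for `0 < M`, `r± (M, a) = M · (1 ± √(1 − (a/M)²))`. Elementary
(Kerr 1963; the tree's `Kerr.rPlus`/`Kerr.rMinus`). [folklore] -/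
theorem Kerr.rPlus_rMinus_eq_mul_normalised {M : ℝ} (hM : 0 < M) (a : ℝ) :
    Kerr.rMinus M a = M * (1 - √(1 - (a / M) ^ 2)) ∧
      Kerr.rPlus M a = M * (1 + √(1 - (a / M) ^ 2)) := by
  have hsq : √(M ^ 2 - a ^ 2) = M * √(1 - (a / M) ^ 2) := by
    have h1 : M ^ 2 - a ^ 2 = M ^ 2 * (1 - (a / M) ^ 2) := by
      field_simp
    rw [h1, Real.sqrt_mul (sq_nonneg M), Real.sqrt_sq hM.le]
  simp only [Kerr.rMinus, Kerr.rPlus, hsq]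
  constructor <;> ring

/-- **The claim lands exactly on the audited pointwise rendering.** From
`hintz_kerr_stability_subextremal_cauchy`, for each `0 < M`, `|a| < M` and each inner radius
`r₀ ∈ (r₋, r₊)` separately: there are `(s, δ, k)` such that for every tolerance `η > 0` some `ε > 0`
serves all b-conormal, `ε`-close vacuum data on `Kerr.slice a r₀` — verbatim the conclusion of
`Literature.Barriers.FinalStateConjecture.SlowlyRotatingKerrFrontierNarrow.conormalData` (the
2026-08-15 audit's consequence form of Thm. 13.1 at `E₀ = ∅`), now obtained from the asserted claim
instead of from the unasserted uniform barrier statement (centre `χ₀ := a/M`, `ρ₀ := r₀/M`).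
Hintz, arXiv:2606.28253, Thm. 13.1. [cite: Hintz2026, Thm. 13.1 (pp. 318–319)] -/
theorem hintz_kerr_stability_subextremal_cauchy.pointwise [Kerr.Facts] [Kerr.SliceFacts]
    (h : hintz_kerr_stability_subextremal_cauchy) (M a : ℝ) (hM : 0 < M)
    (ha : Kerr.IsSubextremal M a) {r₀ : ℝ}
    (hr₀ : r₀ ∈ Set.Ioo (Kerr.rMinus M a) (Kerr.rPlus M a)) :
    ∃ (s : ℕ) (δ : ℝ) (k : ℕ), ∀ η > (0 : ℝ), ∃ ε > (0 : ℝ),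
      ∀ (D : InitialDataSet 𝓘(ℝ, E3) (Kerr.slice a r₀)) [D.metric.HasLeviCivita],
        D.IsVacuumConstraintSolution →
        (∀ s' : ℕ,
          InitialDataSet.dataWeightedSobolevEDist s' δ D (Kerr.data M a r₀ hM.le) < ⊤) →
        InitialDataSet.dataWeightedSobolevEDist s δ D (Kerr.data M a r₀ hM.le) <
          ENNReal.ofReal ε →
        ∀ 𝒟 : VacuumCauchyDevelopment D, 𝒟.IsMaximal →
          ∃ (M' a' : ℝ) (𝒟oc : Set 𝒟.carrier), Kerr.IsSubextremal M' a' ∧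
            |M' - M| + |a' - a| ≤ η ∧
            𝒟.HasCompleteFutureNullInfinityFar ∧
            𝒟.toSpacetime.ConvergesToKerr 𝒟oc M' a' k := by
  have hχ₀ : |a / M| < 1 := by
    rw [abs_div, abs_of_pos hM, div_lt_one hM]
    exact ha
  obtain ⟨hminus, hplus⟩ := Kerr.rPlus_rMinus_eq_mul_normalised hM a
  have hρ₀ : r₀ / M ∈ Set.Ioo (1 - √(1 - (a / M) ^ 2)) (1 + √(1 - (a / M) ^ 2)) := by
    rw [Set.mem_Ioo, lt_div_iff₀ hM, div_lt_iff₀ hM]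
    constructor
    · have := hr₀.1; rw [hminus] at this; linarith
    · have := hr₀.2; rw [hplus] at this; linarith
  obtain ⟨s, δ, k, ς, hς, H⟩ := h (a / M) hχ₀ (r₀ / M) hρ₀
  refine ⟨s, δ, k, fun η hη ↦ ?_⟩
  obtain ⟨ε, hε, Hε⟩ := H M hM η hη
  refine ⟨ε, hε, fun D _ hvac hcon hdist 𝒟 hmax ↦ ?_⟩
  exact Hε a r₀ (by simpa using hς) (by field_simp) hr₀ D hvac hcon hdist 𝒟 hmax

/-- **At the centre of its ball** (the exact Kerr data, distance `0` to themselves, b-conormal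
trivially): granted the claim and the vacuum constraints of the Kerr data (named fact
`Kerr.data_isVacuumConstraintSolution`, hypothesis `hvac`; the Levi-Civita instance is the tree
theorem `PseudoRiemannianMetric.hasLeviCivita`), every maximal vacuum Cauchy development of
`Kerr.data M a r₀`, `|a| < M`, `r₀ ∈ (r₋, r₊)`, has sojourn-complete far `𝓘⁺` and, for every
tolerance `η > 0`, a region converging in `Cᵏ` to a sub-extremal `g_{M',a'}` with
`|M' − M| + |a' − a| ≤ η` (the parameters are not pinned to `(M, a)`: no modulus is transcribed).
Hintz, arXiv:2606.28253, Thm. 1.1; Dafermos–Rodnianski arXiv:0811.0354, §5.1.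
[cite: Hintz2026, Thm. 1.1 (p. 2)] -/
theorem hintz_kerr_stability_subextremal_cauchy.atKerrData [Kerr.Facts] [Kerr.SliceFacts]
    (h : hintz_kerr_stability_subextremal_cauchy)
    (hvac : ∀ (M a r₀ : ℝ), Kerr.data_isVacuumConstraintSolution M a r₀)
    {M a : ℝ} (hM : 0 < M) (ha : Kerr.IsSubextremal M a) {r₀ : ℝ}
    (hr₀ : r₀ ∈ Set.Ioo (Kerr.rMinus M a) (Kerr.rPlus M a)) :
    ∃ k : ℕ, ∀ 𝒟 : VacuumCauchyDevelopment (Kerr.data M a r₀ hM.le), 𝒟.IsMaximal →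
      𝒟.HasCompleteFutureNullInfinityFar ∧
        ∀ η > (0 : ℝ), ∃ (M' a' : ℝ) (𝒟oc : Set 𝒟.carrier), Kerr.IsSubextremal M' a' ∧
          |M' - M| + |a' - a| ≤ η ∧ 𝒟.toSpacetime.ConvergesToKerr 𝒟oc M' a' k := by
  obtain ⟨s, δ, k, H⟩ := h.pointwise M a hM ha hr₀
  haveI := (Kerr.data M a r₀ hM.le).metric.hasLeviCivita
  have hcon : ∀ s' : ℕ, InitialDataSet.dataWeightedSobolevEDist s' δ (Kerr.data M a r₀ hM.le)
      (Kerr.data M a r₀ hM.le) < ⊤ := fun s' ↦ by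
    rw [InitialDataSet.dataWeightedSobolevEDist_self]
    exact ENNReal.zero_lt_top
  have hcap : ∀ η > (0 : ℝ), ∀ 𝒟 : VacuumCauchyDevelopment (Kerr.data M a r₀ hM.le),
      𝒟.IsMaximal → ∃ (M' a' : ℝ) (𝒟oc : Set 𝒟.carrier), Kerr.IsSubextremal M' a' ∧
        |M' - M| + |a' - a| ≤ η ∧ 𝒟.HasCompleteFutureNullInfinityFar ∧
        𝒟.toSpacetime.ConvergesToKerr 𝒟oc M' a' k := by
    intro η hη 𝒟 hmax
    obtain ⟨ε, hε, Hε⟩ := H η hη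
    have h0 : InitialDataSet.dataWeightedSobolevEDist s δ (Kerr.data M a r₀ hM.le)
        (Kerr.data M a r₀ hM.le) < ENNReal.ofReal ε := by
      rw [InitialDataSet.dataWeightedSobolevEDist_self]
      exact ENNReal.ofReal_pos.2 hε
    exact Hε _ (hvac M a r₀ hM.le) hcon h0 𝒟 hmax
  refine ⟨k, fun 𝒟 hmax ↦ ⟨?_, fun η hη ↦ ?_⟩⟩
  · obtain ⟨-, -, -, -, -, hfar, -⟩ := hcap 1 one_pos 𝒟 hmax
    exact hfar
  · obtain ⟨M', a', 𝒟oc, hsub, hpar, -, hconv⟩ := hcap η hη 𝒟 hmax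
    exact ⟨M', a', 𝒟oc, hsub, hpar, hconv⟩

/-! ### The same theorem with the convergence order handed over (`∀ k`)

Re-vendoring (librarian/cite item wi-30700, for the crux `BulkKerrCaptureC2` of
`route-FinalStateConjecture-PhaseMixingCapture`, typing ruling 2026-08-16: capture statements hand
over the summit's `C²` order instead of an adversarial `∃ k`). The ONLY difference with
`hintz_kerr_stability_subextremal_cauchy` is the position of the convergence order: there
`∃ (s, δ, k)` up front, here `∃ (s, δ)` up front and `∀ k` in the conclusion, with the SAME basin
radius `ε` for every `k`.

**Page check (held copy `paper:arxiv-2606.28253`, v2; PDF page = printed page + 172).**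
* Thm. 13.1 (printed p. 318 = PDF p. 490). Hypotheses: (13.1a)
  `γ − γ_{b₀} ∈ H_b^{∞,(E₀,3+ε₀)}(Σ_IVP)`, `k − k_{b₀} ∈ H_b^{∞,(E₀+1,4+ε₀)}(Σ_IVP)` — INFINITE
  b-regularity of the data (the tree's side condition "finite distance at every order `s'`"); (13.1b)
  `‖γ − γ_{b₀}‖_{H_b^{d,(E₀,3+ε₀)}}, ‖k − k_{b₀}‖_{H_b^{d,(E₀+1,4+ε₀)}} < ε` — smallness at ONE finite
  order `d`, where "there exist `ε > 0`, `d ∈ ℕ₀`, … such that the following holds" depend only on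
  `(b₀, ε₀, E₀)` (the tree's `s := d`, fixed before the data and before `k`). Conclusion (13.2):
  `h ∈ H_b^{∞,(E₀,3+ε₀),(⟨E_I^C⟩,3+ε_I),(E₊,3+ε₊),2+ε_K}(φ_S(Ω))` — membership of the metric
  perturbation in an `H_b^∞` space, i.e. the stated decay orders hold for `h` AND ALL ITS
  b-DERIVATIVES, of every order; "Thus, `g` settles down to the Kerr metric `g_b` at the rates
  (1) `O(t_*^{−2−ε_K})` in spatially compact subsets of `{r ≥ m₀}`, (2) …, (3) …, (4) `O(r⁻¹)` in the
  region `r/t_* ≥ C`" (printed p. 319 = PDF p. 491).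
* Thm. 1.1 (printed p. 2 = PDF p. 6) prints the derivative clause in words:
  "`|g_{μν}(t̃, x) − (g_b)_{μν}(t̃, x)| ≲ (1 + t̃)^{−2−ε_K}` for some `ε_K > 0` and for all `x` in a
  compact set; **similarly for finite-order derivatives of `g − g_b` along `(1 + t̃)∂_t̃` and `∂ₓ`**",
  for data smooth and "small in the Sobolev space `H^d(Σ)` for some large `d`".
Hence, in the tree's consequence-form reading already fixed for this source (module docstring and
the docstring of `hintz_kerr_stability_subextremal_cauchy`, paraphrase notes (α)–(η), all of which
apply verbatim), the `Cᵏ` convergence `ConvergesToKerr 𝒟oc M' a' k` holds for EVERY `k : ℕ` at the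
one smallness order `s` and the one basin radius `ε`: the order is universal, not existential. The
instance `k = 2` is `hintz_kerr_stability_subextremal_cauchy_allOrders.orderTwo`; the old `∃ k` fact
follows (`hintz_kerr_stability_subextremal_cauchy_allOrders.toExistsOrder`). -/

/-- **Nonlinear stability of sub-extremal Kerr (Hintz 2026) — Cauchy consequence form, locally
uniform in the centre, convergence in `Cᵏ` for EVERY `k`.** Named fact, UNREFEREED CLAIM; the
re-vendoring of `hintz_kerr_stability_subextremal_cauchy` with the convergence order handed over.

**Statement (tree vocabulary).** For every normalised sub-extremal centre `χ₀ ∈ (−1, 1)` and every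
normalised inner radius `ρ₀ ∈ (1 − √(1 − χ₀²), 1 + √(1 − χ₀²))` there are a smallness order and a
weight `(s, δ)` and a spin radius `ς > 0`; and for every mass `M > 0` and every tolerance `η > 0`
ONE basin radius `ε > 0` serving every spin `a` with `|a/M − χ₀| < ς` at the inner radius
`r₀ = ρ₀ M ∈ (r₋(M,a), r₊(M,a))`: every solution `D` of the vacuum constraints on `Kerr.slice a r₀`
which is b-conormal relative to `Kerr.data M a r₀` at weight `δ` (finite `H^{s'}_δ × H^{s'−1}_{δ+1}`
distance for EVERY order `s'` — (13.1a), `H_b^∞` data, at `E₀ = ∅`) and `ε`-close at the ONE order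
`s` ((13.1b), Hintz's `d`) has all its maximal vacuum Cauchy developments `𝒟` with: a SUB-EXTREMAL
`(M', a')` with `|M' − M| + |a' − a| ≤ η`, sojourn-complete far `𝓘⁺`, and a region `𝒟oc`
converging to `g_{M',a'}` in `Cᵏ` (`ConvergesToKerr 𝒟oc M' a' k`) for every `k : ℕ`.

**Source.** Hintz, arXiv:2606.28253v2, Thm. 13.1 (printed pp. 318–319 = PDF pp. 490–491):
hypotheses (13.1a) (`H_b^∞` data) and (13.1b) (smallness in `H_b^d`, one finite `d` depending only
on `b₀, ε₀, E₀`), conclusion (13.2) `h ∈ H_b^{∞,(E₀,3+ε₀),(⟨E_I^C⟩,3+ε_I),(E₊,3+ε₊),2+ε_K}(φ_S(Ω))`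
(all b-derivatives) and rates (1)–(4); Thm. 1.1 (printed p. 2 = PDF p. 6): "similarly for
finite-order derivatives of `g − g_b` along `(1 + t̃)∂_t̃` and `∂ₓ`"; Remark 13.2 (printed p. 319)
for the local uniformity in the centre; Remark 13.3 (printed pp. 319–320) for the hypersurface.
The paraphrase notes (α)–(η) of `hintz_kerr_stability_subextremal_cauchy` apply verbatim; the only
additional reading is that an `H_b^∞`-membership with the weights of (13.2) is rendered, as there,
by `Cᵏ`-sup convergence on the slabs `{t* = τ}` — now recorded for every `k` (which is what (13.2)
and the quoted clause of Thm. 1.1 print) instead of for one unnamed `k`. Deliberately NOT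
transcribed: the same items (i)–(iv) as in the module docstring (no modulus, no bare finite-order
ball, no uniformity as `|a₀| → m₀`, no polyhomogeneity / `t_*⁻³` sharpening).
[cite: Hintz2026, Thm. 13.1 (pp. 318–319, (13.1a)–(13.2)); Thm. 1.1 (p. 2); Remarks 13.2–13.3 (pp. 319–320)] -/
@[claim "Hintz2026" "under-review"]
def hintz_kerr_stability_subextremal_cauchy_allOrders [Kerr.Facts] [Kerr.SliceFacts] : Prop :=
  ∀ χ₀ : ℝ, |χ₀| < 1 → ∀ ρ₀ ∈ Set.Ioo (1 - √(1 - χ₀ ^ 2)) (1 + √(1 - χ₀ ^ 2)),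
    ∃ (s : ℕ) (δ : ℝ), ∃ ς > (0 : ℝ), ∀ (M : ℝ) (hM : 0 < M), ∀ η > (0 : ℝ), ∃ ε > (0 : ℝ),
      ∀ a r₀ : ℝ, |a / M - χ₀| < ς → r₀ = ρ₀ * M →
        r₀ ∈ Set.Ioo (Kerr.rMinus M a) (Kerr.rPlus M a) →
        ∀ (D : InitialDataSet 𝓘(ℝ, E3) (Kerr.slice a r₀)) [D.metric.HasLeviCivita],
          D.IsVacuumConstraintSolution →
          (∀ s' : ℕ,
            InitialDataSet.dataWeightedSobolevEDist s' δ D (Kerr.data M a r₀ hM.le) < ⊤) →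
          InitialDataSet.dataWeightedSobolevEDist s δ D (Kerr.data M a r₀ hM.le) <
            ENNReal.ofReal ε →
          ∀ 𝒟 : VacuumCauchyDevelopment D, 𝒟.IsMaximal →
            ∃ (M' a' : ℝ) (𝒟oc : Set 𝒟.carrier), Kerr.IsSubextremal M' a' ∧
              |M' - M| + |a' - a| ≤ η ∧
              𝒟.HasCompleteFutureNullInfinityFar ∧
              ∀ k : ℕ, 𝒟.toSpacetime.ConvergesToKerr 𝒟oc M' a' k

/-- **The all-orders claim implies the `∃ k` claim** `hintz_kerr_stability_subextremal_cauchy`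
(take any order, here `k = 2`): the two vendorings of Hintz, arXiv:2606.28253, Thm. 13.1 differ
only in the position of the convergence order. [cite: Hintz2026, Thm. 13.1 (pp. 318–319)] -/
theorem hintz_kerr_stability_subextremal_cauchy_allOrders.toExistsOrder [Kerr.Facts]
    [Kerr.SliceFacts] (h : hintz_kerr_stability_subextremal_cauchy_allOrders) :
    hintz_kerr_stability_subextremal_cauchy := by
  intro χ₀ hχ₀ ρ₀ hρ₀
  obtain ⟨s, δ, ς, hς, H⟩ := h χ₀ hχ₀ ρ₀ hρ₀
  refine ⟨s, δ, 2, ς, hς, fun M hM η hη ↦ ?_⟩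
  obtain ⟨ε, hε, Hε⟩ := H M hM η hη
  refine ⟨ε, hε, fun a r₀ ha hr₀ hr D _ hvac hcon hdist 𝒟 hmax ↦ ?_⟩
  obtain ⟨M', a', 𝒟oc, hsub, hpar, hfar, hconv⟩ := Hε a r₀ ha hr₀ hr D hvac hcon hdist 𝒟 hmax
  exact ⟨M', a', 𝒟oc, hsub, hpar, hfar, hconv 2⟩

/-- **Pointwise form, all orders.** From `hintz_kerr_stability_subextremal_cauchy_allOrders`, for
each `0 < M`, `|a| < M` and each inner radius `r₀ ∈ (r₋, r₊)` separately: there are `(s, δ)` such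
that for every tolerance `η > 0` some `ε > 0` serves all b-conormal, `ε`-close vacuum data on
`Kerr.slice a r₀`, with convergence in `Cᵏ` for every `k` (centre `χ₀ := a/M`, `ρ₀ := r₀/M`; the
proof is that of `hintz_kerr_stability_subextremal_cauchy.pointwise`). Hintz, arXiv:2606.28253,
Thm. 13.1 with (13.2). [cite: Hintz2026, Thm. 13.1 (pp. 318–319)] -/
theorem hintz_kerr_stability_subextremal_cauchy_allOrders.pointwise [Kerr.Facts] [Kerr.SliceFacts]
    (h : hintz_kerr_stability_subextremal_cauchy_allOrders) (M a : ℝ) (hM : 0 < M)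
    (ha : Kerr.IsSubextremal M a) {r₀ : ℝ}
    (hr₀ : r₀ ∈ Set.Ioo (Kerr.rMinus M a) (Kerr.rPlus M a)) :
    ∃ (s : ℕ) (δ : ℝ), ∀ η > (0 : ℝ), ∃ ε > (0 : ℝ),
      ∀ (D : InitialDataSet 𝓘(ℝ, E3) (Kerr.slice a r₀)) [D.metric.HasLeviCivita],
        D.IsVacuumConstraintSolution →
        (∀ s' : ℕ,
          InitialDataSet.dataWeightedSobolevEDist s' δ D (Kerr.data M a r₀ hM.le) < ⊤) →
        InitialDataSet.dataWeightedSobolevEDist s δ D (Kerr.data M a r₀ hM.le) <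
          ENNReal.ofReal ε →
        ∀ 𝒟 : VacuumCauchyDevelopment D, 𝒟.IsMaximal →
          ∃ (M' a' : ℝ) (𝒟oc : Set 𝒟.carrier), Kerr.IsSubextremal M' a' ∧
            |M' - M| + |a' - a| ≤ η ∧
            𝒟.HasCompleteFutureNullInfinityFar ∧
            ∀ k : ℕ, 𝒟.toSpacetime.ConvergesToKerr 𝒟oc M' a' k := by
  have hχ₀ : |a / M| < 1 := by
    rw [abs_div, abs_of_pos hM, div_lt_one hM]
    exact ha
  obtain ⟨hminus, hplus⟩ := Kerr.rPlus_rMinus_eq_mul_normalised hM a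
  have hρ₀ : r₀ / M ∈ Set.Ioo (1 - √(1 - (a / M) ^ 2)) (1 + √(1 - (a / M) ^ 2)) := by
    rw [Set.mem_Ioo, lt_div_iff₀ hM, div_lt_iff₀ hM]
    constructor
    · have := hr₀.1; rw [hminus] at this; linarith
    · have := hr₀.2; rw [hplus] at this; linarith
  obtain ⟨s, δ, ς, hς, H⟩ := h (a / M) hχ₀ (r₀ / M) hρ₀
  refine ⟨s, δ, fun η hη ↦ ?_⟩
  obtain ⟨ε, hε, Hε⟩ := H M hM η hη
  refine ⟨ε, hε, fun D _ hvac hcon hdist 𝒟 hmax ↦ ?_⟩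
  exact Hε a r₀ (by simpa using hς) (by field_simp) hr₀ D hvac hcon hdist 𝒟 hmax

/-- **The order `k = 2` instance** (the summit's `C²` order, the shape consumed by the crux
`BulkKerrCaptureC2` of `route-FinalStateConjecture-PhaseMixingCapture` at each centre): for each
`0 < M`, `|a| < M`, `r₀ ∈ (r₋, r₊)` there are `(s, δ)` with, for every `η > 0`, one `ε > 0` serving all
b-conormal `ε`-close vacuum data on `Kerr.slice a r₀` — sub-extremal final parameters within `η`,
sojourn-complete far `𝓘⁺`, and a region converging to `g_{M',a'}` in `C²`. Hintz,
arXiv:2606.28253, Thm. 13.1 with (13.2) (all orders; here `k = 2`). [cite: Hintz2026, Thm. 13.1 (pp. 318–319)] -/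
theorem hintz_kerr_stability_subextremal_cauchy_allOrders.orderTwo [Kerr.Facts] [Kerr.SliceFacts]
    (h : hintz_kerr_stability_subextremal_cauchy_allOrders) (M a : ℝ) (hM : 0 < M)
    (ha : Kerr.IsSubextremal M a) {r₀ : ℝ}
    (hr₀ : r₀ ∈ Set.Ioo (Kerr.rMinus M a) (Kerr.rPlus M a)) :
    ∃ (s : ℕ) (δ : ℝ), ∀ η > (0 : ℝ), ∃ ε > (0 : ℝ),
      ∀ (D : InitialDataSet 𝓘(ℝ, E3) (Kerr.slice a r₀)) [D.metric.HasLeviCivita],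
        D.IsVacuumConstraintSolution →
        (∀ s' : ℕ,
          InitialDataSet.dataWeightedSobolevEDist s' δ D (Kerr.data M a r₀ hM.le) < ⊤) →
        InitialDataSet.dataWeightedSobolevEDist s δ D (Kerr.data M a r₀ hM.le) <
          ENNReal.ofReal ε →
        ∀ 𝒟 : VacuumCauchyDevelopment D, 𝒟.IsMaximal →
          ∃ (M' a' : ℝ) (𝒟oc : Set 𝒟.carrier), Kerr.IsSubextremal M' a' ∧
            |M' - M| + |a' - a| ≤ η ∧
            𝒟.HasCompleteFutureNullInfinityFar ∧
            𝒟.toSpacetime.ConvergesToKerr 𝒟oc M' a' 2 := by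
  obtain ⟨s, δ, H⟩ := h.pointwise M a hM ha hr₀
  refine ⟨s, δ, fun η hη ↦ ?_⟩
  obtain ⟨ε, hε, Hε⟩ := H η hη
  refine ⟨ε, hε, fun D _ hvac hcon hdist 𝒟 hmax ↦ ?_⟩
  obtain ⟨M', a', 𝒟oc, hsub, hpar, hfar, hconv⟩ := Hε D hvac hcon hdist 𝒟 hmax
  exact ⟨M', a', 𝒟oc, hsub, hpar, hfar, hconv 2⟩

/-! ### The unit leaf `r₀ = M`, locally uniformly in the centre

The crux `BulkKerrCaptureC2` of `route-FinalStateConjecture-PhaseMixingCapture` fixes the inner radius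
at `r₀ = M`, i.e. the normalised inner radius `ρ₀ = 1`, which is admissible at EVERY sub-extremal
centre (`1 ∈ (1 − √(1 − χ₀²), 1 + √(1 − χ₀²))` for `|χ₀| < 1`, and `M ∈ (r₋(M,a), r₊(M,a))` for
`|a| < M`). The two lemmas below record this elementary bookkeeping and the resulting "capture germ at
a centre" — the claim at `ρ₀ = 1` with the spin ball kept (Remark 13.2) and the redundant leaf
hypotheses discharged — which is the shape a Lebesgue-number argument over a compact spin segment
consumes (`Summits/…/Theorems/PhaseMixingCaptureBulkKerrCaptureC2OfClaim.lean`). -/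

/-- The unit-mass leaf radius is admissible at every sub-extremal normalised centre, and the leaf
`r₀ = M` lies strictly between the horizons for every sub-extremal spin: for `|χ| < 1`,
`1 ∈ (1 − √(1 − χ²), 1 + √(1 − χ²))`; for `0 < M`, `|a| < M`, `M ∈ (r₋(M,a), r₊(M,a))`. Elementary
(Kerr 1963; the tree's `Kerr.rPlus`/`Kerr.rMinus`). [folklore] -/
theorem Kerr.unitLeaf_admissible :
    (∀ χ : ℝ, |χ| < 1 → (1 : ℝ) ∈ Set.Ioo (1 - √(1 - χ ^ 2)) (1 + √(1 - χ ^ 2))) ∧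
      ∀ M a : ℝ, 0 < M → Kerr.IsSubextremal M a →
        M ∈ Set.Ioo (Kerr.rMinus M a) (Kerr.rPlus M a) := by
  constructor
  · intro χ hχ
    have hpos : 0 < √(1 - χ ^ 2) := by
      apply Real.sqrt_pos.2
      have h1 : χ ^ 2 < 1 := (sq_lt_one_iff_abs_lt_one χ).2 hχ
      linarith
    exact ⟨by linarith, by linarith⟩
  · intro M a hM ha
    unfold Kerr.IsSubextremal at ha
    have hsq : 0 < M ^ 2 - a ^ 2 := by
      have h1 : |a| ^ 2 < M ^ 2 := pow_lt_pow_left₀ ha (abs_nonneg a) two_ne_zero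
      rw [sq_abs] at h1
      linarith
    have hpos : 0 < √(M ^ 2 - a ^ 2) := Real.sqrt_pos.2 hsq
    simp only [Kerr.rMinus, Kerr.rPlus, Set.mem_Ioo]
    constructor <;> linarith

/-- **Capture germ at a centre, unit leaf, all orders.** From
`hintz_kerr_stability_subextremal_cauchy_allOrders`, around every normalised sub-extremal centre
`χ₀ ∈ (−1, 1)` there are `(s, δ)` and a spin radius `ς > 0`, and per mass `M > 0` and tolerance
`η > 0` ONE basin `ε > 0`, serving every SUB-EXTREMAL spin `a` with `|a/M − χ₀| < ς` at the leaf
`r₀ = M`: b-conormal, `ε`-close vacuum data on `Kerr.slice a M` have all maximal vacuum Cauchy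
developments with sub-extremal final parameters within `η`, sojourn-complete far `𝓘⁺`, and a region
converging to `g_{M',a'}` in `Cᵏ` for every `k` (the claim at `ρ₀ = 1`, `r₀ = 1 · M`, the leaf
hypotheses discharged by `Kerr.unitLeaf_admissible`). Hintz, arXiv:2606.28253v2, Thm. 13.1 with (13.2)
and Remark 13.2 (local uniformity in the centre at fixed inner radius `r = m₀`).
[cite: Hintz2026, Thm. 13.1 (pp. 318–319) and Remark 13.2 (p. 319)] -/
theorem hintz_kerr_stability_subextremal_cauchy_allOrders.atUnitLeaf [Kerr.Facts] [Kerr.SliceFacts]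
    (h : hintz_kerr_stability_subextremal_cauchy_allOrders) (χ₀ : ℝ) (hχ₀ : |χ₀| < 1) :
    ∃ (s : ℕ) (δ : ℝ), ∃ ς > (0 : ℝ), ∀ (M : ℝ) (hM : 0 < M), ∀ η > (0 : ℝ), ∃ ε > (0 : ℝ),
      ∀ a : ℝ, |a / M - χ₀| < ς → Kerr.IsSubextremal M a →
        ∀ (D : InitialDataSet 𝓘(ℝ, E3) (Kerr.slice a M)) [D.metric.HasLeviCivita],
          D.IsVacuumConstraintSolution →
          (∀ s' : ℕ,
            InitialDataSet.dataWeightedSobolevEDist s' δ D (Kerr.data M a M hM.le) < ⊤) →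
          InitialDataSet.dataWeightedSobolevEDist s δ D (Kerr.data M a M hM.le) <
            ENNReal.ofReal ε →
          ∀ 𝒟 : VacuumCauchyDevelopment D, 𝒟.IsMaximal →
            ∃ (M' a' : ℝ) (𝒟oc : Set 𝒟.carrier), Kerr.IsSubextremal M' a' ∧
              |M' - M| + |a' - a| ≤ η ∧
              𝒟.HasCompleteFutureNullInfinityFar ∧
              ∀ k : ℕ, 𝒟.toSpacetime.ConvergesToKerr 𝒟oc M' a' k := by
  obtain ⟨s, δ, ς, hς, H⟩ := h χ₀ hχ₀ 1 (Kerr.unitLeaf_admissible.1 χ₀ hχ₀)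
  refine ⟨s, δ, ς, hς, fun M hM η hη ↦ ?_⟩
  obtain ⟨ε, hε, Hε⟩ := H M hM η hη
  refine ⟨ε, hε, fun a ha hsub D _ hvac hcon hdist 𝒟 hmax ↦ ?_⟩
  exact Hε a M ha (by ring) (Kerr.unitLeaf_admissible.2 M a hM hsub) D hvac hcon hdist 𝒟 hmax

end Literature.Geometry.Lorentzian

end
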